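import Summits.QuantumFields.YangMills.Theorems.SwapVirialDeficitGnomonicJet
import Summits.QuantumFields.YangMills.Theorems.SwapVirialDeficitGnomonicSpeedLeaders
import Mathlib.Analysis.SpecialFunctions.Sqrt
import HarnessLib

/-!
# THIRD-ORDER S-B, part J2a: THE RADIAL PROJECTION OF AN AFFINE LINE CARRIES A 3-JET `(a, a², 3a³)`, `a = ‖w‖/‖u₀‖`
# (free-hands support of ⟨stmt-QuantumFields-24197⟩ `SwapVirialDeficit.SwapGluedStiffness`)

Sequel of ✓`…GnomonicJet` (J1: the 3-jet package, product-closed).  Along the LINEAR Euler dilation `t ↦ eulerDilate t η` of fcl-p3 g45's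
✓`…BlowUpGnomonicDefs` every letter quaternion is the radial projection of an AFFINE LINE `u₀ + t·w` with `w ⊥ u₀`
(`x, y`: `u₀ = ±(1, v₀, 0, 0)`, `w = ±(0, 0, v₁, v₂)` — ✓`gnomonicQuat_trDil`; `z` ∕ followers: `u₀ = ±1`, `w = ±(0, v)` — ✓`gnomonicQuat_smul`), and

  `q(t) = (u₀ + t w)/‖u₀ + t w‖` satisfies `‖q′‖ ≤ a`, `‖q″‖ ≤ a²`, `‖q‴‖ ≤ 3a³` for ALL `t`, `a = ‖w‖/‖u₀‖`

(scaling: `q⁽ᵏ⁾(t) = aᵏ f⁽ᵏ⁾(at)` with `f(s) = (û₀ + sŵ)/√(1+s²)`, `‖f′‖² = (1+s²)⁻²`, `‖f″‖² = (1+4s²)(1+s²)⁻⁴`, `‖f‴‖² = 9(1+4s⁴)(1+s²)⁻⁶`).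
* §1 the affine line: `sq_norm_affine` (`‖u₀ + t w‖² = ‖u₀‖² + ‖w‖²t²`), `inner_affine`, `hasDerivAt_norm_affine` (`r′ = ‖w‖²t/r`), the scalar factor
  `n = r⁻¹` and its three derivatives `hasDerivAt_radialFactor₀/₁/₂` (`n′ = −Bt/r³`, `n″ = −B/r³ + 3B²t²/r⁵`, `n‴ = 9B²t/r⁵ − 15B³t³/r⁷`, `B = ‖w‖²`);
* §2 `sq_norm_smul_add_smul` (`‖αw + βu‖² = α²B + 2αβBt + β²r²`) and the three EXACT norms ∕ bounds `norm_radialJet₁/₂/₃_le`;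
* §3 ★★★ `jet3_radialUnit_affine` — `t ↦ radialUnit (u₀ + t • w)` carries a 3-jet of size `‖w‖/‖u₀‖`;
* §4 the letters: ★★ `jet3_trDilLetter` (`x, y`: size `τ v = √((v₁²+v₂²)/(1+v₀²))`, so `gnoWtr v = 4τ²/(1+τ²)`), ★★ `jet3_smulLetter` (`z` ∕ followers: size
  `√(Σ vᵢ²)`), ★★ `jet3_slavedLetter` (`Ā·x̂·A·ẑ`: size `τ vx + √(Σ vzᵢ²)`), ★★★ `jet3_leader` (every leader `su2Quat (leaderTuple a (dil3 t (X,Y,Z)) μ)`,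
  `a ≠ 0`, carries a 3-jet of size `τ vx + τ vy + √(Σ vzᵢ²)`), `jet3_follower`.
Part J3 turns these into `|d³/dt³ F̂(eulerDilate t η)| ≤ C·L⁴·A³`.

HONEST LABEL: calculus plumbing (no ring, no measure); nothing about ⟨24197⟩ (window-uniform, OPEN), (LW), (M), (HM) is proved; ⟨24194⟩ ∕ ⟨24196⟩ ∕ ⟨24497⟩ OPEN;
item of record ⟨24085⟩ SubOctaveBounded aside ∕ untouched; no crux, rung of record or summit is proved; the Yang–Mills mass gap is NOT proved; no summit is proved
by a line.  THEOREMS ONLY (0 `def`, 0 `sorry`), standard axioms, no local instances.  Seat ym-line-fcl-p3 g47 (cell ym-idea-1, free hands),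
`--supports stmt-QuantumFields-24197`.  References: [folklore].
-/

set_option autoImplicit false

noncomputable section

open Quaternion
open scoped Quaternion RealInnerProductSpace BigOperators
open Literature.MathematicalPhysics.QuantumLattice
open Literature.Analysis.Calculus (radialUnit radialUnit_def norm_radialUnit)
open Summit.QuantumFields.YangMills.Theorems.SwapTwistDeficit.ToronLog (axisPoint)
open Summit.QuantumFields.YangMills.Theorems.SwapVirialDeficit.ZeroModeSigma (su2Quat_quatToSU2_eq_radialUnit slaveP norm_axisUnit dil3 dil3_apply)
open Summit.QuantumFields.YangMills.Theorems.SwapVirialDeficit.BlowUp (leaderTuple)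
open Summit.QuantumFields.YangMills.Theorems.SwapVirialDeficit.BlowUpRing (gnoLetter gnoSign gnoLetter_eq gnoLetter_ne_zero trDil
  dilate_gnoLetter dilateIm_gnoLetter)

namespace Summit.QuantumFields.YangMills.Theorems.SwapVirialDeficit.Gnomonic

/-! ## §1 The affine line `u₀ + t·w`, `w ⊥ u₀`, and the scalar factor `r⁻¹` -/

section Affine

variable {u₀ w : ℍ}

/-- `‖u₀ + t w‖² = ‖u₀‖² + ‖w‖² t²` for `w ⊥ u₀`. [folklore] -/
theorem sq_norm_affine (hw : ⟪u₀, w⟫ = 0) (t : ℝ) : ‖u₀ + t • w‖ ^ 2 = ‖u₀‖ ^ 2 + ‖w‖ ^ 2 * t ^ 2 := by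
  rw [norm_add_sq_real, real_inner_smul_right, hw, norm_smul, Real.norm_eq_abs, mul_pow, sq_abs]; ring

/-- `0 < ‖u₀ + t w‖` for `u₀ ≠ 0`, `w ⊥ u₀`. [folklore] -/
theorem norm_affine_pos (hu : u₀ ≠ 0) (hw : ⟪u₀, w⟫ = 0) (t : ℝ) : 0 < ‖u₀ + t • w‖ := by
  have h := sq_norm_affine hw t
  have h0 : 0 < ‖u₀‖ := norm_pos_iff.2 hu
  nlinarith [norm_nonneg (u₀ + t • w), sq_nonneg t, norm_nonneg w, mul_nonneg (sq_nonneg ‖w‖) (sq_nonneg t)]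

/-- `‖u₀‖² ≤ ‖u₀ + t w‖²`. [folklore] -/
theorem sq_norm_le_sq_norm_affine (hw : ⟪u₀, w⟫ = 0) (t : ℝ) : ‖u₀‖ ^ 2 ≤ ‖u₀ + t • w‖ ^ 2 := by
  rw [sq_norm_affine hw t]; nlinarith [sq_nonneg (‖w‖ * t)]

/-- `⟪w, u₀ + t w⟫ = ‖w‖² t`. [folklore] -/
theorem inner_affine (hw : ⟪u₀, w⟫ = 0) (t : ℝ) : ⟪w, u₀ + t • w⟫ = ‖w‖ ^ 2 * t := by
  rw [inner_add_right, real_inner_comm, hw, real_inner_smul_right, real_inner_self_eq_norm_sq]; ring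

/-- The affine line is differentiable: `d/dt (u₀ + t w) = w`. [folklore] -/
theorem hasDerivAt_affine (u₀ w : ℍ) (t : ℝ) : HasDerivAt (fun t : ℝ => u₀ + t • w) w t := by
  have h := ((hasDerivAt_id' t).smul_const w).const_add u₀
  simpa using h

/-- `r(t) = ‖u₀ + t w‖` is differentiable with `r′ = ‖w‖² t / r` (`r = √(‖u₀‖² + ‖w‖²t²)`). [folklore] -/
theorem hasDerivAt_norm_affine (hu : u₀ ≠ 0) (hw : ⟪u₀, w⟫ = 0) (t : ℝ) :
    HasDerivAt (fun t : ℝ => ‖u₀ + t • w‖) (‖w‖ ^ 2 * t / ‖u₀ + t • w‖) t := by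
  have e : (fun t : ℝ => ‖u₀ + t • w‖) = fun t => Real.sqrt (‖u₀‖ ^ 2 + ‖w‖ ^ 2 * t ^ 2) := by
    funext s; rw [← sq_norm_affine hw s, Real.sqrt_sq (norm_nonneg _)]
  have hr : Real.sqrt (‖u₀‖ ^ 2 + ‖w‖ ^ 2 * t ^ 2) = ‖u₀ + t • w‖ := by rw [← sq_norm_affine hw t, Real.sqrt_sq (norm_nonneg _)]
  have hpos : 0 < ‖u₀‖ ^ 2 + ‖w‖ ^ 2 * t ^ 2 := by rw [← sq_norm_affine hw t]; exact pow_pos (norm_affine_pos hu hw t) 2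
  have h1 : HasDerivAt (fun t : ℝ => ‖u₀‖ ^ 2 + ‖w‖ ^ 2 * t ^ 2) (‖w‖ ^ 2 * (2 * t)) t :=
    (((hasDerivAt_pow 2 t).const_mul (‖w‖ ^ 2)).const_add (‖u₀‖ ^ 2)).congr_deriv (by norm_num)
  have h2 := h1.sqrt hpos.ne'
  rw [e]
  refine h2.congr_deriv ?_
  rw [hr]
  have hr' : ‖u₀ + t • w‖ ≠ 0 := (norm_affine_pos hu hw t).ne'
  field_simp

/-- `n(t) = ‖u₀ + t w‖⁻¹` has `n′ = −‖w‖² t / r³`. [folklore] -/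
theorem hasDerivAt_radialFactor₀ (hu : u₀ ≠ 0) (hw : ⟪u₀, w⟫ = 0) (t : ℝ) :
    HasDerivAt (fun t : ℝ => ‖u₀ + t • w‖⁻¹) (-(‖w‖ ^ 2 * t) / ‖u₀ + t • w‖ ^ 3) t := by
  have hr : ‖u₀ + t • w‖ ≠ 0 := (norm_affine_pos hu hw t).ne'
  have h := (hasDerivAt_norm_affine hu hw t).inv hr
  refine h.congr_deriv ?_
  field_simp

/-- `n′(t) = −‖w‖² t / r³` has derivative `n″ = −‖w‖²/r³ + 3‖w‖⁴t²/r⁵`. [folklore] -/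
theorem hasDerivAt_radialFactor₁ (hu : u₀ ≠ 0) (hw : ⟪u₀, w⟫ = 0) (t : ℝ) :
    HasDerivAt (fun t : ℝ => -(‖w‖ ^ 2 * t) / ‖u₀ + t • w‖ ^ 3)
      (-‖w‖ ^ 2 / ‖u₀ + t • w‖ ^ 3 + 3 * ‖w‖ ^ 4 * t ^ 2 / ‖u₀ + t • w‖ ^ 5) t := by
  have hr : ‖u₀ + t • w‖ ≠ 0 := (norm_affine_pos hu hw t).ne'
  have hnum : HasDerivAt (fun t : ℝ => -(‖w‖ ^ 2 * t)) (-(‖w‖ ^ 2)) t :=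
    (((hasDerivAt_id' t).const_mul (‖w‖ ^ 2)).neg).congr_deriv (by ring)
  have hden : HasDerivAt (fun t : ℝ => ‖u₀ + t • w‖ ^ 3) (3 * ‖u₀ + t • w‖ ^ 2 * (‖w‖ ^ 2 * t / ‖u₀ + t • w‖)) t :=
    ((hasDerivAt_norm_affine hu hw t).pow 3).congr_deriv (by norm_num)
  have h := hnum.div hden (pow_ne_zero 3 hr)
  refine h.congr_deriv ?_
  field_simp
  ring

/-- `n″(t) = −‖w‖²/r³ + 3‖w‖⁴t²/r⁵` has derivative `n‴ = 9‖w‖⁴ t/r⁵ − 15‖w‖⁶ t³/r⁷`. [folklore] -/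
theorem hasDerivAt_radialFactor₂ (hu : u₀ ≠ 0) (hw : ⟪u₀, w⟫ = 0) (t : ℝ) :
    HasDerivAt (fun t : ℝ => -‖w‖ ^ 2 / ‖u₀ + t • w‖ ^ 3 + 3 * ‖w‖ ^ 4 * t ^ 2 / ‖u₀ + t • w‖ ^ 5)
      (9 * ‖w‖ ^ 4 * t / ‖u₀ + t • w‖ ^ 5 - 15 * ‖w‖ ^ 6 * t ^ 3 / ‖u₀ + t • w‖ ^ 7) t := by
  have hr : ‖u₀ + t • w‖ ≠ 0 := (norm_affine_pos hu hw t).ne'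
  have hA : HasDerivAt (fun t : ℝ => -‖w‖ ^ 2 / ‖u₀ + t • w‖ ^ 3)
      ((0 * ‖u₀ + t • w‖ ^ 3 - (-‖w‖ ^ 2) * (3 * ‖u₀ + t • w‖ ^ 2 * (‖w‖ ^ 2 * t / ‖u₀ + t • w‖))) / (‖u₀ + t • w‖ ^ 3) ^ 2) t := by
    have hden : HasDerivAt (fun t : ℝ => ‖u₀ + t • w‖ ^ 3) (3 * ‖u₀ + t • w‖ ^ 2 * (‖w‖ ^ 2 * t / ‖u₀ + t • w‖)) t :=
      ((hasDerivAt_norm_affine hu hw t).pow 3).congr_deriv (by norm_num)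
    exact (hasDerivAt_const t (-‖w‖ ^ 2)).div hden (pow_ne_zero 3 hr)
  have hB : HasDerivAt (fun t : ℝ => 3 * ‖w‖ ^ 4 * t ^ 2 / ‖u₀ + t • w‖ ^ 5)
      ((3 * ‖w‖ ^ 4 * (2 * t) * ‖u₀ + t • w‖ ^ 5 - 3 * ‖w‖ ^ 4 * t ^ 2 * (5 * ‖u₀ + t • w‖ ^ 4 * (‖w‖ ^ 2 * t / ‖u₀ + t • w‖))) /
        (‖u₀ + t • w‖ ^ 5) ^ 2) t := by
    have hnum : HasDerivAt (fun t : ℝ => 3 * ‖w‖ ^ 4 * t ^ 2) (3 * ‖w‖ ^ 4 * (2 * t)) t :=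
      ((hasDerivAt_pow 2 t).const_mul (3 * ‖w‖ ^ 4)).congr_deriv (by norm_num)
    have hden : HasDerivAt (fun t : ℝ => ‖u₀ + t • w‖ ^ 5) (5 * ‖u₀ + t • w‖ ^ 4 * (‖w‖ ^ 2 * t / ‖u₀ + t • w‖)) t :=
      ((hasDerivAt_norm_affine hu hw t).pow 5).congr_deriv (by norm_num)
    exact hnum.div hden (pow_ne_zero 5 hr)
  have h := hA.add hB
  refine h.congr_deriv ?_
  field_simp
  ring

end Affine

/-! ## §2 The three exact norms -/

section Norms

variable {u₀ w : ℍ}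

/-- `‖α w + β (u₀ + t w)‖² = α²‖w‖² + 2αβ‖w‖²t + β²‖u₀ + t w‖²` for `w ⊥ u₀`. [folklore] -/
theorem sq_norm_smul_add_smul (hw : ⟪u₀, w⟫ = 0) (α β t : ℝ) :
    ‖α • w + β • (u₀ + t • w)‖ ^ 2 = α ^ 2 * ‖w‖ ^ 2 + 2 * α * β * (‖w‖ ^ 2 * t) + β ^ 2 * ‖u₀ + t • w‖ ^ 2 := by
  rw [norm_add_sq_real, real_inner_smul_left, real_inner_smul_right, inner_affine hw, norm_smul, norm_smul, Real.norm_eq_abs,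
    Real.norm_eq_abs, mul_pow, mul_pow, sq_abs, sq_abs]
  ring

/-- ★ FIRST jet: `‖r⁻¹ w + n′ (u₀ + t w)‖ ≤ ‖w‖/‖u₀‖` (indeed `‖q′‖² = ‖u₀‖²‖w‖²/r⁴`). [folklore] -/
theorem norm_radialJet₁_le (hu : u₀ ≠ 0) (hw : ⟪u₀, w⟫ = 0) (t : ℝ) :
    ‖‖u₀ + t • w‖⁻¹ • w + (-(‖w‖ ^ 2 * t) / ‖u₀ + t • w‖ ^ 3) • (u₀ + t • w)‖ ≤ ‖w‖ / ‖u₀‖ := by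
  have hr := norm_affine_pos hu hw t
  have hA := norm_pos_iff.2 hu
  set r := ‖u₀ + t • w‖ with hrdef
  set B := ‖w‖ ^ 2 with hBdef
  have hr2 : r ^ 2 = ‖u₀‖ ^ 2 + B * t ^ 2 := sq_norm_affine hw t
  have hB0 : 0 ≤ B := sq_nonneg _
  have hsq : ‖r⁻¹ • w + (-(B * t) / r ^ 3) • (u₀ + t • w)‖ ^ 2 = ‖u₀‖ ^ 2 * B / r ^ 4 := by
    rw [sq_norm_smul_add_smul hw, ← hBdef, ← hrdef]
    have hu2 : ‖u₀‖ ^ 2 = r ^ 2 - B * t ^ 2 := by linarith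
    rw [hu2]; field_simp; ring
  have hle : ‖r⁻¹ • w + (-(B * t) / r ^ 3) • (u₀ + t • w)‖ ^ 2 ≤ (‖w‖ / ‖u₀‖) ^ 2 := by
    rw [hsq, div_pow, ← hBdef, div_le_div_iff₀ (by positivity) (by positivity)]
    have h4 : ‖u₀‖ ^ 2 * ‖u₀‖ ^ 2 ≤ r ^ 4 := by nlinarith [sq_norm_le_sq_norm_affine hw t, sq_nonneg ‖u₀‖]
    nlinarith
  exact (pow_le_pow_iff_left₀ (norm_nonneg _) (by positivity) two_ne_zero).1 hle

/-- ★ SECOND jet: `‖2n′ w + n″ (u₀ + t w)‖ ≤ (‖w‖/‖u₀‖)²` (indeed `‖q″‖² = ‖u₀‖²‖w‖⁴(‖u₀‖² + 4‖w‖²t²)/r⁸`, and `A³(A + 4X) ≤ (A + X)⁴`). [folklore] -/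
theorem norm_radialJet₂_le (hu : u₀ ≠ 0) (hw : ⟪u₀, w⟫ = 0) (t : ℝ) :
    ‖(2 * (-(‖w‖ ^ 2 * t) / ‖u₀ + t • w‖ ^ 3)) • w + (-‖w‖ ^ 2 / ‖u₀ + t • w‖ ^ 3 + 3 * ‖w‖ ^ 4 * t ^ 2 / ‖u₀ + t • w‖ ^ 5) • (u₀ + t • w)‖ ≤
      (‖w‖ / ‖u₀‖) ^ 2 := by
  have hr := norm_affine_pos hu hw t
  have hA := norm_pos_iff.2 hu
  set r := ‖u₀ + t • w‖ with hrdef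
  set B := ‖w‖ ^ 2 with hBdef
  have hB4 : ‖w‖ ^ 4 = B ^ 2 := by rw [hBdef]; ring
  have hr2 : r ^ 2 = ‖u₀‖ ^ 2 + B * t ^ 2 := sq_norm_affine hw t
  have hB0 : 0 ≤ B := sq_nonneg _
  set X := B * t ^ 2 with hXdef
  have hX0 : 0 ≤ X := by positivity
  have hsq : ‖(2 * (-(B * t) / r ^ 3)) • w + (-B / r ^ 3 + 3 * B ^ 2 * t ^ 2 / r ^ 5) • (u₀ + t • w)‖ ^ 2 =
      ‖u₀‖ ^ 2 * B ^ 2 * (‖u₀‖ ^ 2 + 4 * X) / r ^ 8 := by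
    rw [sq_norm_smul_add_smul hw, ← hBdef, ← hrdef]
    have hu2 : ‖u₀‖ ^ 2 = r ^ 2 - B * t ^ 2 := by linarith
    rw [hu2, hXdef]; field_simp; ring
  have key : ‖u₀‖ ^ 2 * (‖u₀‖ ^ 2 * ‖u₀‖ ^ 2) * (‖u₀‖ ^ 2 + 4 * X) ≤ r ^ 8 := by
    have e8 : r ^ 8 = (‖u₀‖ ^ 2 + X) ^ 4 := by rw [hXdef, ← hr2]; ring
    rw [e8]
    nlinarith [pow_nonneg hX0 2, pow_nonneg hX0 3, pow_nonneg hX0 4, mul_nonneg (sq_nonneg ‖u₀‖) hX0,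
      mul_nonneg (mul_nonneg (sq_nonneg ‖u₀‖) (sq_nonneg ‖u₀‖)) (pow_nonneg hX0 2), mul_nonneg (sq_nonneg ‖u₀‖) (pow_nonneg hX0 3)]
  have hle : ‖(2 * (-(B * t) / r ^ 3)) • w + (-B / r ^ 3 + 3 * B ^ 2 * t ^ 2 / r ^ 5) • (u₀ + t • w)‖ ^ 2 ≤ ((‖w‖ / ‖u₀‖) ^ 2) ^ 2 := by
    rw [hsq, show ((‖w‖ / ‖u₀‖) ^ 2) ^ 2 = B ^ 2 / (‖u₀‖ ^ 2 * ‖u₀‖ ^ 2) by rw [hBdef, div_pow, div_pow]; ring,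
      div_le_div_iff₀ (by positivity) (by positivity)]
    have hB2 : 0 ≤ B ^ 2 := sq_nonneg _
    calc ‖u₀‖ ^ 2 * B ^ 2 * (‖u₀‖ ^ 2 + 4 * X) * (‖u₀‖ ^ 2 * ‖u₀‖ ^ 2) = B ^ 2 * (‖u₀‖ ^ 2 * (‖u₀‖ ^ 2 * ‖u₀‖ ^ 2) * (‖u₀‖ ^ 2 + 4 * X)) := by
          ring
      _ ≤ B ^ 2 * r ^ 8 := mul_le_mul_of_nonneg_left key hB2
  rw [hB4]
  exact (pow_le_pow_iff_left₀ (norm_nonneg _) (by positivity) two_ne_zero).1 hle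

/-- ★ THIRD jet: `‖3n″ w + n‴ (u₀ + t w)‖ ≤ 3(‖w‖/‖u₀‖)³` (indeed `‖q‴‖² = 9‖u₀‖²‖w‖⁶(‖u₀‖⁴ + 4‖w‖⁴t⁴)/r¹²`, and `A⁴(A² + 4X²) ≤ (A + X)⁶`). [folklore] -/
theorem norm_radialJet₃_le (hu : u₀ ≠ 0) (hw : ⟪u₀, w⟫ = 0) (t : ℝ) :
    ‖(3 * (-‖w‖ ^ 2 / ‖u₀ + t • w‖ ^ 3 + 3 * ‖w‖ ^ 4 * t ^ 2 / ‖u₀ + t • w‖ ^ 5)) • w +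
        (9 * ‖w‖ ^ 4 * t / ‖u₀ + t • w‖ ^ 5 - 15 * ‖w‖ ^ 6 * t ^ 3 / ‖u₀ + t • w‖ ^ 7) • (u₀ + t • w)‖ ≤ 3 * (‖w‖ / ‖u₀‖) ^ 3 := by
  have hr := norm_affine_pos hu hw t
  have hA := norm_pos_iff.2 hu
  set r := ‖u₀ + t • w‖ with hrdef
  set B := ‖w‖ ^ 2 with hBdef
  have hB4 : ‖w‖ ^ 4 = B ^ 2 := by rw [hBdef]; ring
  have hB6 : ‖w‖ ^ 6 = B ^ 3 := by rw [hBdef]; ring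
  have hr2 : r ^ 2 = ‖u₀‖ ^ 2 + B * t ^ 2 := sq_norm_affine hw t
  have hB0 : 0 ≤ B := sq_nonneg _
  set X := B * t ^ 2 with hXdef
  have hX0 : 0 ≤ X := by positivity
  have hsq : ‖(3 * (-B / r ^ 3 + 3 * B ^ 2 * t ^ 2 / r ^ 5)) • w + (9 * B ^ 2 * t / r ^ 5 - 15 * B ^ 3 * t ^ 3 / r ^ 7) • (u₀ + t • w)‖ ^ 2 =
      9 * ‖u₀‖ ^ 2 * B ^ 3 * ((‖u₀‖ ^ 2) ^ 2 + 4 * X ^ 2) / r ^ 12 := by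
    rw [sq_norm_smul_add_smul hw, ← hBdef, ← hrdef]
    have hu2 : ‖u₀‖ ^ 2 = r ^ 2 - B * t ^ 2 := by linarith
    rw [hu2, hXdef]; field_simp; ring
  have key : (‖u₀‖ ^ 2) ^ 4 * ((‖u₀‖ ^ 2) ^ 2 + 4 * X ^ 2) ≤ r ^ 12 := by
    have e12 : r ^ 12 = (‖u₀‖ ^ 2 + X) ^ 6 := by rw [hXdef, ← hr2]; ring
    rw [e12]
    set U := ‖u₀‖ ^ 2 with hU
    have hU0 : 0 ≤ U := sq_nonneg _
    have hexp : (U + X) ^ 6 - U ^ 4 * (U ^ 2 + 4 * X ^ 2) =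
        6 * U ^ 5 * X + 11 * U ^ 4 * X ^ 2 + 20 * U ^ 3 * X ^ 3 + 15 * U ^ 2 * X ^ 4 + 6 * U * X ^ 5 + X ^ 6 := by ring
    have hnn : 0 ≤ 6 * U ^ 5 * X + 11 * U ^ 4 * X ^ 2 + 20 * U ^ 3 * X ^ 3 + 15 * U ^ 2 * X ^ 4 + 6 * U * X ^ 5 + X ^ 6 := by positivity
    linarith
  have hle : ‖(3 * (-B / r ^ 3 + 3 * B ^ 2 * t ^ 2 / r ^ 5)) • w + (9 * B ^ 2 * t / r ^ 5 - 15 * B ^ 3 * t ^ 3 / r ^ 7) • (u₀ + t • w)‖ ^ 2 ≤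
      (3 * (‖w‖ / ‖u₀‖) ^ 3) ^ 2 := by
    rw [hsq, show (3 * (‖w‖ / ‖u₀‖) ^ 3) ^ 2 = 9 * B ^ 3 / (‖u₀‖ ^ 2) ^ 3 by rw [hBdef, mul_pow, div_pow, div_pow]; ring,
      div_le_div_iff₀ (by positivity) (by positivity)]
    have hB3 : 0 ≤ 9 * B ^ 3 := by positivity
    calc 9 * ‖u₀‖ ^ 2 * B ^ 3 * ((‖u₀‖ ^ 2) ^ 2 + 4 * X ^ 2) * (‖u₀‖ ^ 2) ^ 3 = 9 * B ^ 3 * ((‖u₀‖ ^ 2) ^ 4 * ((‖u₀‖ ^ 2) ^ 2 + 4 * X ^ 2)) := by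
          ring
      _ ≤ 9 * B ^ 3 * r ^ 12 := mul_le_mul_of_nonneg_left key hB3
  rw [hB4, hB6]
  exact (pow_le_pow_iff_left₀ (norm_nonneg _) (by positivity) two_ne_zero).1 hle

end Norms

/-! ## §3 The radial projection of an affine line carries a 3-jet of size `‖w‖/‖u₀‖` -/

/-- `a•x + (a•x + b•y) = (2a)•x + b•y`. [folklore] -/
theorem smul_add_smul_two (a b : ℝ) (x y : ℍ) : a • x + (a • x + b • y) = (2 * a) • x + b • y := by
  rw [two_mul, add_smul]; abel

/-- `a•x + (a•x + (a•x + b•y)) = (3a)•x + b•y`. [folklore] -/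
theorem smul_add_smul_three (a b : ℝ) (x y : ℍ) : a • x + (a • x + (a • x + b • y)) = (3 * a) • x + b • y := by
  rw [show (3 : ℝ) * a = a + a + a by ring, add_smul, add_smul]; abel

/-- ★★★ **THE RADIAL PROJECTION OF AN AFFINE LINE CARRIES A 3-JET OF SIZE `a = ‖w‖/‖u₀‖`**: for `u₀ ≠ 0` and `w ⊥ u₀` the path
`t ↦ radialUnit (u₀ + t • w) = (u₀ + t w)/‖u₀ + t w‖` has three derivatives everywhere with `‖q′‖ ≤ a`, `‖q″‖ ≤ a²`, `‖q‴‖ ≤ 3a³`, and norm `1`. [folklore] -/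
theorem jet3_radialUnit_affine {u₀ w : ℍ} (hu : u₀ ≠ 0) (hw : ⟪u₀, w⟫ = 0) :
    ∃ f₁ f₂ f₃ : ℝ → ℍ, (∀ t, HasDerivAt (fun t : ℝ => radialUnit (u₀ + t • w)) (f₁ t) t) ∧ (∀ t, HasDerivAt f₁ (f₂ t) t) ∧
      (∀ t, HasDerivAt f₂ (f₃ t) t) ∧
      ∀ t, ‖radialUnit (u₀ + t • w)‖ ≤ 1 ∧ ‖f₁ t‖ ≤ ‖w‖ / ‖u₀‖ ∧ ‖f₂ t‖ ≤ (‖w‖ / ‖u₀‖) ^ 2 ∧ ‖f₃ t‖ ≤ 3 * (‖w‖ / ‖u₀‖) ^ 3 := by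
  have hd₀ := hasDerivAt_radialFactor₀ hu hw
  have hd₁ := hasDerivAt_radialFactor₁ hu hw
  have hd₂ := hasDerivAt_radialFactor₂ hu hw
  have hu' : ∀ t, HasDerivAt (fun t : ℝ => u₀ + t • w) w t := hasDerivAt_affine u₀ w
  refine ⟨fun t => ‖u₀ + t • w‖⁻¹ • w + (-(‖w‖ ^ 2 * t) / ‖u₀ + t • w‖ ^ 3) • (u₀ + t • w),
    fun t => (-(‖w‖ ^ 2 * t) / ‖u₀ + t • w‖ ^ 3) • w + ((-(‖w‖ ^ 2 * t) / ‖u₀ + t • w‖ ^ 3) • w +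
      (-‖w‖ ^ 2 / ‖u₀ + t • w‖ ^ 3 + 3 * ‖w‖ ^ 4 * t ^ 2 / ‖u₀ + t • w‖ ^ 5) • (u₀ + t • w)),
    fun t => (-‖w‖ ^ 2 / ‖u₀ + t • w‖ ^ 3 + 3 * ‖w‖ ^ 4 * t ^ 2 / ‖u₀ + t • w‖ ^ 5) • w +
      ((-‖w‖ ^ 2 / ‖u₀ + t • w‖ ^ 3 + 3 * ‖w‖ ^ 4 * t ^ 2 / ‖u₀ + t • w‖ ^ 5) • w +
        ((-‖w‖ ^ 2 / ‖u₀ + t • w‖ ^ 3 + 3 * ‖w‖ ^ 4 * t ^ 2 / ‖u₀ + t • w‖ ^ 5) • w +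
          (9 * ‖w‖ ^ 4 * t / ‖u₀ + t • w‖ ^ 5 - 15 * ‖w‖ ^ 6 * t ^ 3 / ‖u₀ + t • w‖ ^ 7) • (u₀ + t • w))),
    fun t => ?_, fun t => ?_, fun t => ?_, fun t => ⟨?_, ?_, ?_, ?_⟩⟩
  · exact (hd₀ t).smul (hu' t)
  · exact ((hd₀ t).smul_const w).add ((hd₁ t).smul (hu' t))
  · exact ((hd₁ t).smul_const w).add (((hd₁ t).smul_const w).add ((hd₂ t).smul (hu' t)))
  · exact (norm_radialUnit (norm_pos_iff.1 (norm_affine_pos hu hw t))).le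
  · exact norm_radialJet₁_le hu hw t
  · beta_reduce
    rw [smul_add_smul_two]
    exact norm_radialJet₂_le hu hw t
  · beta_reduce
    rw [smul_add_smul_three]
    exact norm_radialJet₃_le hu hw t

end Summit.QuantumFields.YangMills.Theorems.SwapVirialDeficit.Gnomonic

end
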